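import Summits.QuantumFields.YangMills.Theorems.UnitScaleTiltProp7FirstVariationMultiplier
import Summits.QuantumFields.YangMills.Theorems.UnitScaleTiltProp7Growth142T3ChartELStat
import HarnessLib

/-!
# Route `UnitScaleTilt`, crux K1 «MinimiserStabilityRegPr» (stmt-QuantumFields-19200), route-R row (δ′) FILE 2a (★★OWNER g27 ACK 58 (2) ∕ ACK 62 (3), 2026-08-28) —
# THE WEAK EULER–LAGRANGE LETTER AT A FIBRE POINT AND THE LAGRANGE-MULTIPLIER BOUND UNDER IT:
# `|Lin_W(A)| ≤ 2ε₀L^{−(K−n)}·Σ_c‖(d/ds)W̄^{(K−n)}(Γ₀(s))(c)|₀‖` for a STATIONARY (not necessarily minimising) `W ∈ 𝔅_k(V) ∩ (6)(ε₀)`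

Cell `ym3-torus`, keyed width hand `ym-routeR-w2` (gen 2).  THEOREMS ONLY (0 `def`, 0 `sorry`); `--supports stmt-QuantumFields-19200`, count-neutral.  YM₃ on T³ is a ladder
rung (R3), not the Clay problem; nothing here claims a stub, the crux, d = 4 or the mass gap.

WHY.  The multiplier chain of the route-R lane — `Prop7FirstVariationMultiplier.abs_lin_le_constraint_velocity` (w1) → `Prop7FirstVariationExactPairing.abs_lin_le_sum_norm_trueLinIter`
∕ `exists_multiplier_functional` (★routeR-w2 g1) → `Prop7FirstVariationMultiplierBound` (FILE 1 of this seat) — is stated at an R2-CRITICAL `U₀` (`IsCritR2`: a minimiser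
of (5) over print's regular fibre (6)(e)), the currency of the route-R stubs.  The EX knit of record (`Prop7StubEXOfChartPiecesTwS4.stubEX_of_chartPiecesTwS4`) and the α-P
lane's JOINT-ROW door (★w4-19200 g4, `Prop7LocMinOfSliceRows` ∕ `…LocMinOfJointRow`) sit at a configuration `W` that carries only the E–L CLAUSE `hEL` (stationarity of
(5) along every bondwise-differentiable curve in `𝔅_k(V)` through `W`, the letter of `Prop7Growth142T3ChartELStat.lin_eq_zero_of_fibreEL_of_gaugeLift`); there the
minimality of `W` is the knit's OUTPUT, so a door supplier may not assume `IsCritR2`.  w1's proof uses criticality at exactly ONE point — the Euler–Lagrange equation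
`Lin_{U₀}(ξ) = 0` along p2's corrected lift (`Prop7FirstVariationFibreCurve.exists_fibre_curve_lin_eq_zero_of_isCritR2`, last line).  This file isolates that point as
ONE displayed letter, the WEAK E–L CLAUSE `hELw` («`Lin_W(ξ) = 0` for the velocity `ξ` of every bondwise-differentiable curve through `W` that lies in `𝔅_k(V)` for `t`
NEAR `0`» — no gauge lift, no regular ball), proves it from BOTH currencies (`hEL` of the EX knit: patch the curve to `W` where it leaves the fibre; `IsCritR2`: the regular
fibre is open around `U₀`), and re-runs w1's corrector bookkeeping under `hELw` verbatim.  FILE 2b (`Prop7FirstVariationMultiplierBoundWeakEL`) then carries the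
`Q`-currency bound and the bounded multiplier ∕ Riesz field to every `hELw`-stationary `W`.

WHAT IS PROVED (ns `…Theorems.Prop7FirstVariationWeakEL`; T³, SU(2); `Lin_W(ξ)` = the letter of `Prop8Criticality.lin_eq_zero_of_isMinOn_of_hasDerivAt`).
* §1 ★ `weakEL_of_fibreEL` — the EX knit's `hEL` (VERBATIM as in `lin_eq_zero_of_fibreEL_of_gaugeLift`) ⟹ `hELw` (curve patched by `if γ t ∈ 𝔅_k(V) then γ t else W`,
  which agrees with `γ` near `0`; `Prop7Growth142T3ChartELStat.hasDerivAt_wilsonAction4_of_hasDerivAt_mulStar` identifies the derivative);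
  ★ `weakEL_of_isCritR2` — `IsCritR2 F n K hnK V U₀` ⟹ `hELw` at `U₀` (`Prop8Criticality.exists_ball_subset_regPr` + `lin_eq_zero_of_isMinOn_of_hasDerivAt`).
* §2 `exists_fibre_curve_of_mem_fibre` — p2's corrected lift DISPLAYED (`γ(0) = U₀`, bondwise differentiable, in `𝔅_k(V)` near `0`, velocities `ξ`, `γ = Γ₀` off `T₀`)
  for ANY `U₀ ∈ 𝔅_k(V) ∩ 𝔘_k(ε₀)`, `10¹⁰L⁶ε₀ ≤ 1` — `exists_fibre_curve_lin_eq_zero_of_isCritR2` without its criticality input and without its last clause.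
* §3 ★★ `abs_lin_le_constraint_velocity_weakEL` — w1's multiplier bound with `hcrit` REPLACED by `(hU₀fib : U₀ ∈ 𝔅_k(V))` + `hELw`; proof = w1's, line for line
  (minimal tower, corrected lift, current identity + divergence clause of (6), `k`-fold corrector bound `∏ ≤ 2L^{2(K−n)}`).

HONEST SCOPE.  Re-run of landed bookkeeping under a weaker displayed letter; no new analysis; the constant `2ε₀L^{−(K−n)}` is w1's (`‖J‖_∞·‖R_tree‖_{1→1}`).

References: T. Bałaban, CMP 102 (1985) 277–309 [Balaban1985Variational] ((2), (6) p.278, (26)–(27) p.282, (127) p.297, (141)–(143) p.299); CMP 99 (1985) 389–434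
[Balaban1985BackgroundPropagators] ((3.11) p.392); CMP 99 (1985) 75–102 [Balaban1985RegularSpaces] ((1.28)–(1.30) p.81).
-/

set_option autoImplicit false

noncomputable section

open scoped BigOperators Matrix.Norms.L2Operator Matrix Topology
open Filter NormedSpace

namespace Summit.QuantumFields.YangMills.Theorems.Prop7FirstVariationWeakEL

open Literature.MathematicalPhysics.QuantumFieldTheory.Balaban1983to89
open T4Continuum AveragingRT BlockAveraging BlockAveragingHaarAC BlockAveragingEMLHaarAC ExpMeanLog
open T3ContinuumYM3Torus T3UnitLawDensityEML T3ConstrainedMinimiser T3TiltDescent T3DescentFibreTower T3LevelShift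
open T3RegularMinimiser T3PrintedRegularMinimiser T3Thm1CarrierNative
open B10Eq27TorusAxialLog (unitsField toUField)
open B10Eq68TorusRegularity (covDivT)
open Summit.QuantumFields.YangMills.Theorems.BlockAvgCorrector (stokesConst stokesConst_nonneg stokesConst_T3 emlWeight_le_one)
open Summit.QuantumFields.YangMills.Theorems.Prop8Criticality (exists_iter_lift_curve lin_eq_zero_of_isMinOn_of_hasDerivAt exists_ball_subset_regPr)
open Summit.QuantumFields.YangMills.Theorems.Prop8CriticalityAllL (t0_data_of_regPr_allL)
open Summit.QuantumFields.YangMills.Theorems.IterPlaqSmallAllL (plaqSmall_iter_T3_allL)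
open Summit.QuantumFields.YangMills.Theorems.Prop7CovariantCoercivity (abs_re_trace_le)
open Summit.QuantumFields.YangMills.Theorems.Prop7FirstVariationCurrent (lin_eq_neg_half_sum_re_trace_mul_covDivT)
open Summit.QuantumFields.YangMills.Theorems.Prop7FibreVelocity (sum_norm_deriv_sub_le_prod)
open Summit.QuantumFields.YangMills.Theorems.Prop7FirstVariationMultiplier (exists_minimal_tower prod_weight_le_T3)
open Summit.QuantumFields.YangMills.Theorems.Prop7Growth142T3ChartELStat (hasDerivAt_wilsonAction4_of_hasDerivAt_mulStar)

variable (F : T3Family) {n K : ℕ}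

/-! ## §1 The weak Euler–Lagrange letter from both currencies -/

/-- ★ **THE EX KNIT'S E–L CLAUSE IMPLIES THE WEAK E–L LETTER.**  If the Wilson action is stationary at `W` along every bondwise-differentiable curve IN `𝔅_k(V)`
through `W` (the EX knit's `hEL`, verbatim), then `Lin_W(ξ) = 0` for the velocity `ξ` of every bondwise-differentiable curve `γ` through `W` that lies in `𝔅_k(V)` for `t`
NEAR `0`: replace `γ` by `φ(t) = γ(t)` if `γ(t) ∈ 𝔅_k(V)`, `= W` otherwise — `φ = γ` near `0`, so `φ` is differentiable at `0` with the same velocities, and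
`(A ∘ φ)′(0) = Lin_W(ξ)` by `hasDerivAt_wilsonAction4_of_hasDerivAt_mulStar`. [cite: Balaban1985Variational, (141) p.299, (26)-(27) p.282] -/
theorem weakEL_of_fibreEL (hnK : n ≤ K)
    {V : GaugeField (F.P n) 0 (Matrix.specialUnitaryGroup (Fin 2) ℂ)} {W : GaugeField (F.P K) 0 (Matrix.specialUnitaryGroup (Fin 2) ℂ)}
    (hEL : ∀ φ : ℝ → GaugeField (F.P K) 0 (Matrix.specialUnitaryGroup (Fin 2) ℂ), φ 0 = W → (∀ t, φ t ∈ fibre F ℰp n K hnK V) →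
      (∀ b : PBond (F.P K) 0, DifferentiableAt ℝ (fun t => ((φ t b : Matrix.specialUnitaryGroup (Fin 2) ℂ) : Matrix (Fin 2) (Fin 2) ℂ)) 0) →
        deriv (fun t => wilsonAction4 (φ t)) 0 = 0)
    (γ : ℝ → GaugeField (F.P K) 0 (Matrix.specialUnitaryGroup (Fin 2) ℂ)) (ξ : PBond (F.P K) 0 → Matrix (Fin 2) (Fin 2) ℂ) (hγ0 : γ 0 = W)
    (hγdiff : ∀ b : PBond (F.P K) 0, DifferentiableAt ℝ (fun t : ℝ => (γ t b : Matrix (Fin 2) (Fin 2) ℂ)) 0)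
    (hγfib : ∀ᶠ t in 𝓝 (0 : ℝ), γ t ∈ fibre F ℰp n K hnK V)
    (hξ : ∀ b : PBond (F.P K) 0, HasDerivAt (fun t : ℝ => (γ t b : Matrix (Fin 2) (Fin 2) ℂ) * star (W b : Matrix (Fin 2) (Fin 2) ℂ)) (ξ b) 0) :
    ∑ p : Plaq (F.P K) 0, (1 / 2) * ((((((GaugeField.plaqHol W p : Matrix.specialUnitaryGroup (Fin 2) ℂ) : Matrix (Fin 2) (Fin 2) ℂ)) - 1)ᴴ
      * ((ξ ⟨p.src, p.μ⟩
          + (W ⟨p.src, p.μ⟩ : Matrix (Fin 2) (Fin 2) ℂ) * ξ ⟨p.src.shift p.μ, p.ν⟩ * star (W ⟨p.src, p.μ⟩ : Matrix (Fin 2) (Fin 2) ℂ)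
          - ((W ⟨p.src, p.μ⟩ * W ⟨p.src.shift p.μ, p.ν⟩ * (W ⟨p.src.shift p.ν, p.μ⟩)⁻¹ : Matrix.specialUnitaryGroup (Fin 2) ℂ) : Matrix (Fin 2) (Fin 2) ℂ)
              * ξ ⟨p.src.shift p.ν, p.μ⟩
              * star ((W ⟨p.src, p.μ⟩ * W ⟨p.src.shift p.μ, p.ν⟩ * (W ⟨p.src.shift p.ν, p.μ⟩)⁻¹ : Matrix.specialUnitaryGroup (Fin 2) ℂ) : Matrix (Fin 2) (Fin 2) ℂ)
          - ((GaugeField.plaqHol W p : Matrix.specialUnitaryGroup (Fin 2) ℂ) : Matrix (Fin 2) (Fin 2) ℂ) * ξ ⟨p.src, p.ν⟩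
              * star ((GaugeField.plaqHol W p : Matrix.specialUnitaryGroup (Fin 2) ℂ) : Matrix (Fin 2) (Fin 2) ℂ))
        * ((GaugeField.plaqHol W p : Matrix.specialUnitaryGroup (Fin 2) ℂ) : Matrix (Fin 2) (Fin 2) ℂ))).trace).re = 0 := by
  classical
  have hWfib : W ∈ fibre F ℰp n K hnK V := by rw [← hγ0]; exact hγfib.self_of_nhds
  -- the patched curve
  set φ : ℝ → GaugeField (F.P K) 0 (Matrix.specialUnitaryGroup (Fin 2) ℂ) := fun t => if γ t ∈ fibre F ℰp n K hnK V then γ t else W with hφ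
  have hφγ : ∀ᶠ t in 𝓝 (0 : ℝ), φ t = γ t := by
    filter_upwards [hγfib] with t ht
    show (if γ t ∈ fibre F ℰp n K hnK V then γ t else W) = γ t
    rw [if_pos ht]
  have hφ0 : φ 0 = W := by rw [hφγ.self_of_nhds, hγ0]
  have hφfib : ∀ t, φ t ∈ fibre F ℰp n K hnK V := by
    intro t
    show (if γ t ∈ fibre F ℰp n K hnK V then γ t else W) ∈ fibre F ℰp n K hnK V
    split_ifs with h
    · exact h
    · exact hWfib
  have hφγb : ∀ b : PBond (F.P K) 0, (fun t : ℝ => ((φ t b : Matrix.specialUnitaryGroup (Fin 2) ℂ) : Matrix (Fin 2) (Fin 2) ℂ)) =ᶠ[𝓝 0] fun t : ℝ => ((γ t b : Matrix.specialUnitaryGroup (Fin 2) ℂ) : Matrix (Fin 2) (Fin 2) ℂ) :=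
    fun b => hφγ.mono fun t (ht : φ t = γ t) => show ((φ t b : Matrix.specialUnitaryGroup (Fin 2) ℂ) : Matrix (Fin 2) (Fin 2) ℂ) = ((γ t b : Matrix.specialUnitaryGroup (Fin 2) ℂ) : Matrix (Fin 2) (Fin 2) ℂ) by rw [ht]
  have hφdiff : ∀ b : PBond (F.P K) 0, DifferentiableAt ℝ (fun t => ((φ t b : Matrix.specialUnitaryGroup (Fin 2) ℂ) : Matrix (Fin 2) (Fin 2) ℂ)) 0 :=
    fun b => (hγdiff b).congr_of_eventuallyEq (hφγb b)
  have hφξ : ∀ b : PBond (F.P K) 0, HasDerivAt (fun t : ℝ => (φ t b : Matrix (Fin 2) (Fin 2) ℂ) * star (W b : Matrix (Fin 2) (Fin 2) ℂ)) (ξ b) 0 :=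
    fun b => (hξ b).congr_of_eventuallyEq (hφγ.mono fun t (ht : φ t = γ t) =>
      show ((φ t b : Matrix.specialUnitaryGroup (Fin 2) ℂ) : Matrix (Fin 2) (Fin 2) ℂ) * star ((W b : Matrix.specialUnitaryGroup (Fin 2) ℂ) : Matrix (Fin 2) (Fin 2) ℂ) = ((γ t b : Matrix.specialUnitaryGroup (Fin 2) ℂ) : Matrix (Fin 2) (Fin 2) ℂ) * star ((W b : Matrix.specialUnitaryGroup (Fin 2) ℂ) : Matrix (Fin 2) (Fin 2) ℂ) by rw [ht])
  have hD := hasDerivAt_wilsonAction4_of_hasDerivAt_mulStar W φ hφ0 ξ hφξ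
  have h0 := hEL φ hφ0 hφfib hφdiff
  rw [hD.deriv] at h0
  exact h0

/-- ★ **R2-CRITICALITY IMPLIES THE WEAK E–L LETTER.**  If `U₀` minimises (5) over print's regular fibre `(6)(e) ∩ 𝔅_k(V)` (`IsCritR2`), then `Lin_{U₀}(ξ) = 0` for the
velocity `ξ` of every bondwise-differentiable curve through `U₀` lying in `𝔅_k(V)` near `0`: the regular space `𝔘_k(e)` is open around `U₀`
(`Prop8Criticality.exists_ball_subset_regPr`), so the curve lies in `(6)(e) ∩ 𝔅_k(V)` near `0`, and `lin_eq_zero_of_isMinOn_of_hasDerivAt` applies — the last step of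
`Prop7FirstVariationFibreCurve.exists_fibre_curve_lin_eq_zero_of_isCritR2`, displayed. [cite: Balaban1985Variational, (6) p.278, (141) p.299] -/
theorem weakEL_of_isCritR2 (hnK : n ≤ K)
    {V : GaugeField (F.P n) 0 (Matrix.specialUnitaryGroup (Fin 2) ℂ)} {U₀ : GaugeField (F.P K) 0 (Matrix.specialUnitaryGroup (Fin 2) ℂ)} (hcrit : IsCritR2 F n K hnK V U₀)
    (γ : ℝ → GaugeField (F.P K) 0 (Matrix.specialUnitaryGroup (Fin 2) ℂ)) (ξ : PBond (F.P K) 0 → Matrix (Fin 2) (Fin 2) ℂ) (hγ0 : γ 0 = U₀)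
    (hγdiff : ∀ b : PBond (F.P K) 0, DifferentiableAt ℝ (fun t : ℝ => (γ t b : Matrix (Fin 2) (Fin 2) ℂ)) 0)
    (hγfib : ∀ᶠ t in 𝓝 (0 : ℝ), γ t ∈ fibre F ℰp n K hnK V)
    (hξ : ∀ b : PBond (F.P K) 0, HasDerivAt (fun t : ℝ => (γ t b : Matrix (Fin 2) (Fin 2) ℂ) * star (U₀ b : Matrix (Fin 2) (Fin 2) ℂ)) (ξ b) 0) :
    ∑ p : Plaq (F.P K) 0, (1 / 2) * ((((((GaugeField.plaqHol U₀ p : Matrix.specialUnitaryGroup (Fin 2) ℂ) : Matrix (Fin 2) (Fin 2) ℂ)) - 1)ᴴ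
      * ((ξ ⟨p.src, p.μ⟩
          + (U₀ ⟨p.src, p.μ⟩ : Matrix (Fin 2) (Fin 2) ℂ) * ξ ⟨p.src.shift p.μ, p.ν⟩ * star (U₀ ⟨p.src, p.μ⟩ : Matrix (Fin 2) (Fin 2) ℂ)
          - ((U₀ ⟨p.src, p.μ⟩ * U₀ ⟨p.src.shift p.μ, p.ν⟩ * (U₀ ⟨p.src.shift p.ν, p.μ⟩)⁻¹ : Matrix.specialUnitaryGroup (Fin 2) ℂ) : Matrix (Fin 2) (Fin 2) ℂ)
              * ξ ⟨p.src.shift p.ν, p.μ⟩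
              * star ((U₀ ⟨p.src, p.μ⟩ * U₀ ⟨p.src.shift p.μ, p.ν⟩ * (U₀ ⟨p.src.shift p.ν, p.μ⟩)⁻¹ : Matrix.specialUnitaryGroup (Fin 2) ℂ) : Matrix (Fin 2) (Fin 2) ℂ)
          - ((GaugeField.plaqHol U₀ p : Matrix.specialUnitaryGroup (Fin 2) ℂ) : Matrix (Fin 2) (Fin 2) ℂ) * ξ ⟨p.src, p.ν⟩
              * star ((GaugeField.plaqHol U₀ p : Matrix.specialUnitaryGroup (Fin 2) ℂ) : Matrix (Fin 2) (Fin 2) ℂ))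
        * ((GaugeField.plaqHol U₀ p : Matrix.specialUnitaryGroup (Fin 2) ℂ) : Matrix (Fin 2) (Fin 2) ℂ))).trace).re = 0 := by
  obtain ⟨e, -, hreg, hmin⟩ := hcrit
  have hU₀rege : RegPr F n K e U₀ := ((mem_regFibrePr_iff (F := F)).mp hreg).2
  obtain ⟨δ, hδ, hball⟩ := exists_ball_subset_regPr F n K e U₀ hU₀rege
  have hγS : ∀ᶠ t in 𝓝 (0 : ℝ), γ t ∈ regFibrePr F n K hnK e V := by
    have hnear : ∀ b : PBond (F.P K) 0, ∀ᶠ t in 𝓝 (0 : ℝ),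
        ‖((γ t b : Matrix.specialUnitaryGroup (Fin 2) ℂ) : Matrix (Fin 2) (Fin 2) ℂ) - (U₀ b : Matrix (Fin 2) (Fin 2) ℂ)‖ < δ := by
      intro b
      have h1 : Tendsto (fun t : ℝ => ((γ t b : Matrix.specialUnitaryGroup (Fin 2) ℂ) : Matrix (Fin 2) (Fin 2) ℂ)) (𝓝 0)
          (𝓝 ((U₀ b : Matrix.specialUnitaryGroup (Fin 2) ℂ) : Matrix (Fin 2) (Fin 2) ℂ)) := by
        have := (hγdiff b).continuousAt.tendsto
        rwa [hγ0] at this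
      have h2 := h1 (Metric.ball_mem_nhds _ hδ)
      filter_upwards [h2] with t ht
      rwa [Set.mem_preimage, Metric.mem_ball, dist_eq_norm] at ht
    filter_upwards [hγfib, Filter.eventually_all.mpr hnear] with t ht hdist
    exact (mem_regFibrePr_iff (F := F)).mpr ⟨ht, hball (γ t) hdist⟩
  exact lin_eq_zero_of_isMinOn_of_hasDerivAt hmin γ hγS hγ0 ξ hξ

/-! ## §2 p2's corrected lift through a fibre point, displayed -/

/-- **THE CORRECTED LIFT OF AN AMBIENT FAMILY INTO THE FIBRE THROUGH ANY `U₀ ∈ 𝔅_k(V) ∩ 𝔘_k(ε₀)`** (`10¹⁰L⁶ε₀ ≤ 1`; p2's `exists_iter_lift_curve` with the data of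
`Prop8CriticalityAllL.t0_data_of_regPr_allL`): for every tower `T` (closed downwards, `T_{K−n}` = everything) and every bondwise-differentiable ambient family `Γ₀` through
`U₀` there are a family `γ` and velocities `ξ` with `γ(0) = U₀`, `γ` bondwise differentiable, `γ(t) ∈ 𝔅_k(V)` for `t` near `0`, `HasDerivAt (γ(·)(b)U₀(b)*) (ξ b) 0` at
every bond, and `γ(t)(b) = Γ₀(t)(b)` near `0` off `T₀` — `exists_fibre_curve_lin_eq_zero_of_isCritR2` WITHOUT criticality (and without its E–L clause).
[cite: Balaban1985Variational, (127) p.297, (158) p.302] -/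
theorem exists_fibre_curve_of_mem_fibre (hnK : n ≤ K)
    {V : GaugeField (F.P n) 0 (Matrix.specialUnitaryGroup (Fin 2) ℂ)} {U₀ : GaugeField (F.P K) 0 (Matrix.specialUnitaryGroup (Fin 2) ℂ)}
    (hU₀fib : U₀ ∈ fibre F ℰp n K hnK V) {ε₀ : ℝ} (hε₀ : 0 < ε₀) (hε : 10 ^ 10 * (F.L : ℝ) ^ 6 * ε₀ ≤ 1) (hU₀reg : RegPr F n K ε₀ U₀)
    (T : (i : ℕ) → Set (PBond (F.P K) i)) (hT : ∀ i, i < K - n → ∀ c : PBond (F.P K) (i + 1), c ∈ T (i + 1) → centralBond c ∈ T i)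
    (hTk : ∀ c : PBond (F.P K) (K - n), c ∈ T (K - n))
    (Γ₀ : ℝ → GaugeField (F.P K) 0 (Matrix.specialUnitaryGroup (Fin 2) ℂ)) (hΓ₀0 : Γ₀ 0 = U₀)
    (hΓ₀diff : ∀ b : PBond (F.P K) 0, DifferentiableAt ℝ (fun t : ℝ => (Γ₀ t b : Matrix (Fin 2) (Fin 2) ℂ)) 0) :
    ∃ (γ : ℝ → GaugeField (F.P K) 0 (Matrix.specialUnitaryGroup (Fin 2) ℂ)) (ξ : PBond (F.P K) 0 → Matrix (Fin 2) (Fin 2) ℂ),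
      γ 0 = U₀ ∧
      (∀ b : PBond (F.P K) 0, DifferentiableAt ℝ (fun t : ℝ => (γ t b : Matrix (Fin 2) (Fin 2) ℂ)) 0) ∧
      (∀ᶠ t in 𝓝 (0 : ℝ), γ t ∈ fibre F ℰp n K hnK V) ∧
      (∀ b : PBond (F.P K) 0,
        HasDerivAt (fun t : ℝ => (γ t b : Matrix (Fin 2) (Fin 2) ℂ) * star (U₀ b : Matrix (Fin 2) (Fin 2) ℂ)) (ξ b) 0) ∧
      (∀ b : PBond (F.P K) 0, b ∉ T 0 → ∀ᶠ t in 𝓝 (0 : ℝ), γ t b = Γ₀ t b) := by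
  classical
  obtain ⟨ht₀, hsmall, hU₀it⟩ := t0_data_of_regPr_allL F hε₀ hε hU₀reg
  have hk : K - n ≤ (F.P K).m + (F.P K).K := by
    show K - n ≤ F.m + K; omega
  have hsm : ∀ i, i < K - n → PlaqSmall ((10800 * (F.L : ℝ) + 1) * ε₀)
      (Averaging.iter (fun i => blockAvg (P := F.P K) (j := i) (expMeanLogSU (n := Fin 2))) i (Γ₀ 0)) := by
    rw [hΓ₀0]; exact hU₀it
  obtain ⟨γ, hγ0, hγdiff, hγev, hγT⟩ := exists_iter_lift_curve (P := F.P K) ht₀ hsmall (K - n) hk Γ₀ hΓ₀diff hsm T hT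
    (fun _ => Averaging.iter (fun i => blockAvg (P := F.P K) (j := i) (expMeanLogSU (n := Fin 2))) (K - n) U₀)
    (fun _ => differentiableAt_const _) (by rw [hΓ₀0]) (fun c hc => absurd (hTk c) hc)
  have hγ0' : γ 0 = U₀ := hγ0.trans hΓ₀0
  have hγfib : ∀ᶠ t in 𝓝 (0 : ℝ), γ t ∈ fibre F ℰp n K hnK V := by
    filter_upwards [hγev] with t ht
    rw [mem_fibre_iff] at hU₀fib ⊢
    rw [← hU₀fib]
    exact congrArg (fun W => fieldShift _ W) ht
  set ξ : PBond (F.P K) 0 → Matrix (Fin 2) (Fin 2) ℂ := fun b =>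
    deriv (fun t : ℝ => ((γ t b : Matrix.specialUnitaryGroup (Fin 2) ℂ) : Matrix (Fin 2) (Fin 2) ℂ) * star (U₀ b : Matrix (Fin 2) (Fin 2) ℂ)) 0 with hξ
  have hξd : ∀ b, HasDerivAt (fun t : ℝ => ((γ t b : Matrix.specialUnitaryGroup (Fin 2) ℂ) : Matrix (Fin 2) (Fin 2) ℂ) * star (U₀ b : Matrix (Fin 2) (Fin 2) ℂ))
      (ξ b) 0 :=
    fun b => ((hγdiff b).mul_const _).hasDerivAt
  exact ⟨γ, ξ, hγ0', hγdiff, hγfib, hξd, hγT⟩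

/-! ## §3 The multiplier bound under the weak E–L letter -/

/-- ★★ **THE LAGRANGE-MULTIPLIER BOUND AT A STATIONARY FIBRE POINT: `|Lin_{U₀}(A)| ≤ 2ε₀L^{−(K−n)}·Σ_c‖(d/ds)Γ̄₀^{(K−n)}(s)(c)|₀‖`.**  Let `U₀ ∈ 𝔅_k(V) ∩ 𝔘_k(ε₀)`
(print's (2): plaquettes AND small divergence), `10¹⁰L⁶ε₀ ≤ 1`, satisfy the WEAK E–L LETTER `hELw` (§1: implied by the EX knit's `hEL` and by `IsCritR2`), and let
`Γ₀(s)` be ANY bondwise differentiable family of fine `SU(2)` fields through `U₀` with velocities `A_bU₀(b)`.  Then the first variation of the action along `A` is bounded by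
`2ε₀L^{−(K−n)}` times the `ℓ¹` norm over the level-`(K−n)` bonds of the velocity of the `(K−n)`-fold (0.4)-average of `Γ₀` at `s = 0`.  PROOF = w1's
`Prop7FirstVariationMultiplier.abs_lin_le_constraint_velocity` line for line, with the Euler–Lagrange input read from `hELw` along §2's lift.
[cite: Balaban1985Variational, (2), (6) p.278, (47)–(48) p.287, (127) p.297, (141)–(143) p.299; Balaban1985BackgroundPropagators, (3.11) p.392] -/
theorem abs_lin_le_constraint_velocity_weakEL (hnK : n ≤ K)
    {V : GaugeField (F.P n) 0 (Matrix.specialUnitaryGroup (Fin 2) ℂ)} {U₀ : GaugeField (F.P K) 0 (Matrix.specialUnitaryGroup (Fin 2) ℂ)}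
    (hU₀fib : U₀ ∈ fibre F ℰp n K hnK V)
    (hELw : ∀ (γ : ℝ → GaugeField (F.P K) 0 (Matrix.specialUnitaryGroup (Fin 2) ℂ)) (ξ : PBond (F.P K) 0 → Matrix (Fin 2) (Fin 2) ℂ), γ 0 = U₀ →
      (∀ b : PBond (F.P K) 0, DifferentiableAt ℝ (fun t : ℝ => (γ t b : Matrix (Fin 2) (Fin 2) ℂ)) 0) →
      (∀ᶠ t in 𝓝 (0 : ℝ), γ t ∈ fibre F ℰp n K hnK V) →
      (∀ b : PBond (F.P K) 0, HasDerivAt (fun t : ℝ => (γ t b : Matrix (Fin 2) (Fin 2) ℂ) * star (U₀ b : Matrix (Fin 2) (Fin 2) ℂ)) (ξ b) 0) →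
        ∑ p : Plaq (F.P K) 0, (1 / 2) * ((((((GaugeField.plaqHol U₀ p : Matrix.specialUnitaryGroup (Fin 2) ℂ) : Matrix (Fin 2) (Fin 2) ℂ)) - 1)ᴴ
          * ((ξ ⟨p.src, p.μ⟩
              + (U₀ ⟨p.src, p.μ⟩ : Matrix (Fin 2) (Fin 2) ℂ) * ξ ⟨p.src.shift p.μ, p.ν⟩ * star (U₀ ⟨p.src, p.μ⟩ : Matrix (Fin 2) (Fin 2) ℂ)
              - ((U₀ ⟨p.src, p.μ⟩ * U₀ ⟨p.src.shift p.μ, p.ν⟩ * (U₀ ⟨p.src.shift p.ν, p.μ⟩)⁻¹ : Matrix.specialUnitaryGroup (Fin 2) ℂ) : Matrix (Fin 2) (Fin 2) ℂ)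
                  * ξ ⟨p.src.shift p.ν, p.μ⟩
                  * star ((U₀ ⟨p.src, p.μ⟩ * U₀ ⟨p.src.shift p.μ, p.ν⟩ * (U₀ ⟨p.src.shift p.ν, p.μ⟩)⁻¹ : Matrix.specialUnitaryGroup (Fin 2) ℂ) : Matrix (Fin 2) (Fin 2) ℂ)
              - ((GaugeField.plaqHol U₀ p : Matrix.specialUnitaryGroup (Fin 2) ℂ) : Matrix (Fin 2) (Fin 2) ℂ) * ξ ⟨p.src, p.ν⟩
                  * star ((GaugeField.plaqHol U₀ p : Matrix.specialUnitaryGroup (Fin 2) ℂ) : Matrix (Fin 2) (Fin 2) ℂ))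
            * ((GaugeField.plaqHol U₀ p : Matrix.specialUnitaryGroup (Fin 2) ℂ) : Matrix (Fin 2) (Fin 2) ℂ))).trace).re = 0)
    {ε₀ : ℝ} (hε₀ : 0 < ε₀) (hε : 10 ^ 10 * (F.L : ℝ) ^ 6 * ε₀ ≤ 1) (hU₀reg : RegPr F n K ε₀ U₀)
    (Γ₀ : ℝ → GaugeField (F.P K) 0 (Matrix.specialUnitaryGroup (Fin 2) ℂ)) (hΓ₀0 : Γ₀ 0 = U₀)
    (A : PBond (F.P K) 0 → Matrix (Fin 2) (Fin 2) ℂ)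
    (hΓ₀d : ∀ b : PBond (F.P K) 0, HasDerivAt (fun s : ℝ => (Γ₀ s b : Matrix (Fin 2) (Fin 2) ℂ)) (A b * (U₀ b : Matrix (Fin 2) (Fin 2) ℂ)) 0) :
    |∑ p : Plaq (F.P K) 0, (1 / 2) * ((((((GaugeField.plaqHol U₀ p : Matrix.specialUnitaryGroup (Fin 2) ℂ) : Matrix (Fin 2) (Fin 2) ℂ)) - 1)ᴴ
          * ((A ⟨p.src, p.μ⟩
              + (U₀ ⟨p.src, p.μ⟩ : Matrix (Fin 2) (Fin 2) ℂ) * A ⟨p.src.shift p.μ, p.ν⟩ * star (U₀ ⟨p.src, p.μ⟩ : Matrix (Fin 2) (Fin 2) ℂ)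
              - ((U₀ ⟨p.src, p.μ⟩ * U₀ ⟨p.src.shift p.μ, p.ν⟩ * (U₀ ⟨p.src.shift p.ν, p.μ⟩)⁻¹ : Matrix.specialUnitaryGroup (Fin 2) ℂ) : Matrix (Fin 2) (Fin 2) ℂ)
                  * A ⟨p.src.shift p.ν, p.μ⟩
                  * star ((U₀ ⟨p.src, p.μ⟩ * U₀ ⟨p.src.shift p.μ, p.ν⟩ * (U₀ ⟨p.src.shift p.ν, p.μ⟩)⁻¹ : Matrix.specialUnitaryGroup (Fin 2) ℂ) : Matrix (Fin 2) (Fin 2) ℂ)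
              - ((GaugeField.plaqHol U₀ p : Matrix.specialUnitaryGroup (Fin 2) ℂ) : Matrix (Fin 2) (Fin 2) ℂ) * A ⟨p.src, p.ν⟩
                  * star ((GaugeField.plaqHol U₀ p : Matrix.specialUnitaryGroup (Fin 2) ℂ) : Matrix (Fin 2) (Fin 2) ℂ))
            * ((GaugeField.plaqHol U₀ p : Matrix.specialUnitaryGroup (Fin 2) ℂ) : Matrix (Fin 2) (Fin 2) ℂ))).trace).re|
      ≤ 2 * ε₀ * ((F.L : ℝ) ^ (K - n))⁻¹ * ∑ c : PBond (F.P K) (K - n),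
          ‖deriv (fun s : ℝ => ((Averaging.iter (fun i => blockAvg (P := F.P K) (j := i) (expMeanLogSU (n := Fin 2))) (K - n) (Γ₀ s) c :
              Matrix.specialUnitaryGroup (Fin 2) ℂ) : Matrix (Fin 2) (Fin 2) ℂ)) 0‖ := by
  classical
  -- the minimal tower and p2's corrected lift with its velocity and the Euler–Lagrange equation
  obtain ⟨T, hTk, hTcl, hTmin⟩ := exists_minimal_tower (F.P K) (K - n)
  obtain ⟨γ, ξ, hγ0, hγdiff, hγfib, hξd, hγT⟩ := exists_fibre_curve_of_mem_fibre F hnK hU₀fib hε₀ hε hU₀reg T hTcl hTk Γ₀ hΓ₀0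
    (fun b => (hΓ₀d b).differentiableAt)
  have hlin := hELw γ ξ hγ0 hγdiff hγfib hξd
  -- (a) `|Lin(A)| ≤ ε₀ (L^{K−n})⁻³ Σ_b ‖A_b − ξ_b‖` (current identity + divergence clause)
  have hUU : ∀ b : PBond (F.P K) 0, (U₀ b : Matrix (Fin 2) (Fin 2) ℂ) * star (U₀ b : Matrix (Fin 2) (Fin 2) ℂ) = 1 :=
    fun b => Matrix.mem_unitaryGroup_iff.mp (U₀ b).2.1
  have hstep1 : |∑ p : Plaq (F.P K) 0, (1 / 2) * ((((((GaugeField.plaqHol U₀ p : Matrix.specialUnitaryGroup (Fin 2) ℂ) : Matrix (Fin 2) (Fin 2) ℂ)) - 1)ᴴ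
          * ((A ⟨p.src, p.μ⟩
              + (U₀ ⟨p.src, p.μ⟩ : Matrix (Fin 2) (Fin 2) ℂ) * A ⟨p.src.shift p.μ, p.ν⟩ * star (U₀ ⟨p.src, p.μ⟩ : Matrix (Fin 2) (Fin 2) ℂ)
              - ((U₀ ⟨p.src, p.μ⟩ * U₀ ⟨p.src.shift p.μ, p.ν⟩ * (U₀ ⟨p.src.shift p.ν, p.μ⟩)⁻¹ : Matrix.specialUnitaryGroup (Fin 2) ℂ) : Matrix (Fin 2) (Fin 2) ℂ)
                  * A ⟨p.src.shift p.ν, p.μ⟩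
                  * star ((U₀ ⟨p.src, p.μ⟩ * U₀ ⟨p.src.shift p.μ, p.ν⟩ * (U₀ ⟨p.src.shift p.ν, p.μ⟩)⁻¹ : Matrix.specialUnitaryGroup (Fin 2) ℂ) : Matrix (Fin 2) (Fin 2) ℂ)
              - ((GaugeField.plaqHol U₀ p : Matrix.specialUnitaryGroup (Fin 2) ℂ) : Matrix (Fin 2) (Fin 2) ℂ) * A ⟨p.src, p.ν⟩
                  * star ((GaugeField.plaqHol U₀ p : Matrix.specialUnitaryGroup (Fin 2) ℂ) : Matrix (Fin 2) (Fin 2) ℂ))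
            * ((GaugeField.plaqHol U₀ p : Matrix.specialUnitaryGroup (Fin 2) ℂ) : Matrix (Fin 2) (Fin 2) ℂ))).trace).re|
      ≤ ε₀ * (((F.L : ℝ) ^ (K - n)) ^ 3)⁻¹ * ∑ b : PBond (F.P K) 0, ‖A b - ξ b‖ := by
    have hUreg3 : DivSmall F n K ε₀ U₀ := hU₀reg.2
    rw [← sub_zero (∑ p : Plaq (F.P K) 0, _), ← hlin, lin_eq_neg_half_sum_re_trace_mul_covDivT, lin_eq_neg_half_sum_re_trace_mul_covDivT, ← mul_sub,
      ← Finset.sum_sub_distrib]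
    have hsub : ∀ b : PBond (F.P K) 0,
        ((A b * covDivT 1 (unitsField (toUField U₀)) b.dir b.src).trace).re - ((ξ b * covDivT 1 (unitsField (toUField U₀)) b.dir b.src).trace).re
          = (((A b - ξ b) * covDivT 1 (unitsField (toUField U₀)) b.dir b.src).trace).re := by
      intro b; rw [Matrix.sub_mul, Matrix.trace_sub, Complex.sub_re]
    simp only [hsub]
    have hpow : ((F.L : ℝ)⁻¹) ^ (3 * (K - n)) = (((F.L : ℝ) ^ (K - n)) ^ 3)⁻¹ := by rw [inv_pow, mul_comm, pow_mul]
    have hb : ∀ b : PBond (F.P K) 0, |(((A b - ξ b) * covDivT 1 (unitsField (toUField U₀)) b.dir b.src).trace).re|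
        ≤ 2 * (‖A b - ξ b‖ * (ε₀ * (((F.L : ℝ) ^ (K - n)) ^ 3)⁻¹)) := by
      intro b
      have h1 := abs_re_trace_le ((A b - ξ b) * covDivT 1 (unitsField (toUField U₀)) b.dir b.src)
      have hJ : ‖covDivT 1 (unitsField (toUField U₀)) b.dir b.src‖ ≤ ε₀ * (((F.L : ℝ) ^ (K - n)) ^ 3)⁻¹ := by rw [← hpow]; exact (hUreg3 b).le
      calc |(((A b - ξ b) * covDivT 1 (unitsField (toUField U₀)) b.dir b.src).trace).re|
          ≤ 2 * ‖(A b - ξ b) * covDivT 1 (unitsField (toUField U₀)) b.dir b.src‖ := by simpa using h1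
        _ ≤ 2 * (‖A b - ξ b‖ * (ε₀ * (((F.L : ℝ) ^ (K - n)) ^ 3)⁻¹)) :=
            mul_le_mul_of_nonneg_left ((norm_mul_le _ _).trans (mul_le_mul_of_nonneg_left hJ (norm_nonneg _))) (by norm_num)
    rw [abs_mul, abs_neg, abs_of_pos (by norm_num : (0 : ℝ) < 1 / 2)]
    calc (1 / 2) * |∑ b : PBond (F.P K) 0, (((A b - ξ b) * covDivT 1 (unitsField (toUField U₀)) b.dir b.src).trace).re|
        ≤ (1 / 2) * ∑ b : PBond (F.P K) 0, 2 * (‖A b - ξ b‖ * (ε₀ * (((F.L : ℝ) ^ (K - n)) ^ 3)⁻¹)) :=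
          mul_le_mul_of_nonneg_left ((Finset.abs_sum_le_sum_abs _ _).trans (Finset.sum_le_sum fun b _ => hb b)) (by norm_num)
      _ = ε₀ * (((F.L : ℝ) ^ (K - n)) ^ 3)⁻¹ * ∑ b : PBond (F.P K) 0, ‖A b - ξ b‖ := by
          rw [← Finset.mul_sum, ← Finset.sum_mul]; ring
  -- (b) `‖A_b − ξ_b‖ = ‖γ̇_b − Γ̇₀,b‖`
  have hAξ : ∀ b : PBond (F.P K) 0, ‖A b - ξ b‖
      = ‖deriv (fun s : ℝ => ((γ s b : Matrix.specialUnitaryGroup (Fin 2) ℂ) : Matrix (Fin 2) (Fin 2) ℂ)) 0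
          - deriv (fun s : ℝ => ((Γ₀ s b : Matrix.specialUnitaryGroup (Fin 2) ℂ) : Matrix (Fin 2) (Fin 2) ℂ)) 0‖ := by
    intro b
    have h1 : ξ b = deriv (fun s : ℝ => ((γ s b : Matrix.specialUnitaryGroup (Fin 2) ℂ) : Matrix (Fin 2) (Fin 2) ℂ)) 0 * star (U₀ b : Matrix (Fin 2) (Fin 2) ℂ) :=
      (hξd b).unique ((hγdiff b).hasDerivAt.mul_const _)
    have h2 : A b = deriv (fun s : ℝ => ((Γ₀ s b : Matrix.specialUnitaryGroup (Fin 2) ℂ) : Matrix (Fin 2) (Fin 2) ℂ)) 0 * star (U₀ b : Matrix (Fin 2) (Fin 2) ℂ) := by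
      rw [(hΓ₀d b).deriv, mul_assoc, hUU b, mul_one]
    rw [h1, h2, ← sub_mul, CStarRing.norm_mul_mem_unitary _ (Unitary.star_mem (U₀ b).2.1), norm_sub_rev]
  -- (c) the `k`-fold corrector bound with the geometric profile
  obtain ⟨ht₀, hsmall, -⟩ := t0_data_of_regPr_allL F hε₀ hε hU₀reg
  have hL3 : (3 : ℝ) ≤ F.L := by
    have h : 3 ≤ F.L := by obtain ⟨a, ha⟩ := F.hL.1; have := F.hL.2; omega
    exact_mod_cast h
  have hL0 : (0 : ℝ) < F.L := by linarith
  have hε7 : 10 ^ 7 * (F.L : ℝ) ^ 3 * ε₀ ≤ 1 := by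
    refine le_trans ?_ hε
    have hL36 : (F.L : ℝ) ^ 3 ≤ (F.L : ℝ) ^ 6 := pow_le_pow_right₀ (by linarith) (by norm_num)
    have : (10 : ℝ) ^ 7 * (F.L : ℝ) ^ 3 ≤ 10 ^ 10 * (F.L : ℝ) ^ 6 := by nlinarith [pow_pos hL0 3]
    exact mul_le_mul_of_nonneg_right this hε₀.le
  have hv24 : stokesConst (F.P K) * ((10800 * (F.L : ℝ) + 1) * ε₀) ≤ 1 / 24 := by
    have := emlWeight_le_one (F.P K); linarith
  have ht0 : ∀ i : ℕ, 0 < (10800 * (F.L : ℝ) + 1) * ((F.L : ℝ) ^ (2 * i) * regThreshold F n K ε₀) := fun i => by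
    have : 0 < regThreshold F n K ε₀ := by unfold regThreshold; positivity
    positivity
  have hreg : ∀ i : ℕ, i < K - n → (F.L : ℝ) ^ (2 * i) * regThreshold F n K ε₀ ≤ ε₀ := by
    intro i hi
    rw [regThreshold, inv_pow, mul_left_comm, ← div_eq_mul_inv]
    refine mul_le_of_le_one_right hε₀.le ?_
    rw [div_le_one (by positivity)]
    exact pow_le_pow_right₀ (by linarith) (by omega)
  have htle : ∀ i : ℕ, i < K - n → (10800 * (F.L : ℝ) + 1) * ((F.L : ℝ) ^ (2 * i) * regThreshold F n K ε₀) ≤ (10800 * (F.L : ℝ) + 1) * ε₀ :=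
    fun i hi => mul_le_mul_of_nonneg_left (hreg i hi) (by positivity)
  have hρ : ∀ i : ℕ, i < K - n → 148 * (stokesConst (F.P K) * ((10800 * (F.L : ℝ) + 1) * ((F.L : ℝ) ^ (2 * i) * regThreshold F n K ε₀)))
      < (((((F.P K).L : ℝ) ^ ((F.P K).d - 1)))⁻¹) := by
    intro i hi
    have hd : (F.P K).d - 1 = 2 := by rw [T3Family.P_d]
    rw [hd, stokesConst_T3]
    show _ < (((F.L : ℝ) ^ 2))⁻¹
    have h1 : 148 * (25 * (F.L : ℝ) ^ 2 / 4 * ((10800 * (F.L : ℝ) + 1) * ((F.L : ℝ) ^ (2 * i) * regThreshold F n K ε₀)))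
        ≤ 925 * (F.L : ℝ) ^ 2 * ((10800 * (F.L : ℝ) + 1) * ε₀) := by
      have := htle i hi
      nlinarith [pow_pos hL0 2]
    have h2 : 925 * (F.L : ℝ) ^ 2 * ((10800 * (F.L : ℝ) + 1) * ε₀) < (((F.L : ℝ) ^ 2))⁻¹ := by
      rw [← one_div, lt_div_iff₀ (by positivity)]
      have h5 : (F.L : ℝ) ^ 4 * (10800 * (F.L : ℝ) + 1) ≤ 10801 * (F.L : ℝ) ^ 6 := by nlinarith [pow_pos hL0 4, pow_pos hL0 5]
      have h6 : 925 * (F.L : ℝ) ^ 2 * ((10800 * (F.L : ℝ) + 1) * ε₀) * (F.L : ℝ) ^ 2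
          = 925 * ((F.L : ℝ) ^ 4 * (10800 * (F.L : ℝ) + 1)) * ε₀ := by ring
      rw [h6]
      nlinarith [pow_pos hL0 6, hε₀]
    exact lt_of_le_of_lt h1 h2
  have hk : K - n ≤ (F.P K).m + (F.P K).K := by show K - n ≤ F.m + K; omega
  have hsm : ∀ i, i < K - n → PlaqSmall ((10800 * (F.L : ℝ) + 1) * ((F.L : ℝ) ^ (2 * i) * regThreshold F n K ε₀))
      (Averaging.iter (fun i => blockAvg (P := F.P K) (j := i) (expMeanLogSU (n := Fin 2))) i (Γ₀ 0)) := by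
    intro i hi; rw [hΓ₀0]; exact plaqSmall_iter_T3_allL F n K hε₀ hε7 U₀ hU₀reg.1 i hi.le
  have hγΓ0 : γ 0 = Γ₀ 0 := by rw [hγ0, hΓ₀0]
  have hB := sum_norm_deriv_sub_le_prod (P := F.P K) (t := fun i => (10800 * (F.L : ℝ) + 1) * ((F.L : ℝ) ^ (2 * i) * regThreshold F n K ε₀))
    ht₀ hv24 ht0 (K - n) hk htle hρ Γ₀ γ (fun b => (hΓ₀d b).differentiableAt) hγdiff hγΓ0 hsm T hTmin hγT
  -- (d) the lift's `k`-fold average is constant `= Ū₀^{(k)}`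
  have hconst : ∀ c : PBond (F.P K) (K - n),
      deriv (fun s : ℝ => ((Averaging.iter (fun i => blockAvg (P := F.P K) (j := i) (expMeanLogSU (n := Fin 2))) (K - n) (γ s) c :
        Matrix.specialUnitaryGroup (Fin 2) ℂ) : Matrix (Fin 2) (Fin 2) ℂ)) 0 = 0 := by
    intro c
    have hev : (fun s : ℝ => ((Averaging.iter (fun i => blockAvg (P := F.P K) (j := i) (expMeanLogSU (n := Fin 2))) (K - n) (γ s) c :
        Matrix.specialUnitaryGroup (Fin 2) ℂ) : Matrix (Fin 2) (Fin 2) ℂ)) =ᶠ[𝓝 0]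
        fun _ => ((Averaging.iter (fun i => blockAvg (P := F.P K) (j := i) (expMeanLogSU (n := Fin 2))) (K - n) U₀ c :
          Matrix.specialUnitaryGroup (Fin 2) ℂ) : Matrix (Fin 2) (Fin 2) ℂ) := by
      filter_upwards [hγfib] with s hs
      rw [mem_fibre_iff] at hs hU₀fib
      have h1 := congrArg (fieldShift (F.sitesPerDir_eq (m := F.m) (K := n) (j := 0) (m' := F.m) (K' := K) (j' := K - n) (by omega)).symm) (hs.trans hU₀fib.symm)
      rw [descendTo, descendTo, fieldShift_fieldShift_symm, fieldShift_fieldShift_symm] at h1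
      rw [h1]
    rw [hev.deriv_eq, deriv_const]
  simp only [hconst, zero_sub, norm_neg] at hB
  -- (e) assembly
  have hW := prod_weight_le_T3 F n K hε₀ hε
  have hS0 : 0 ≤ ∑ c : PBond (F.P K) (K - n), ‖deriv (fun s : ℝ => ((Averaging.iter (fun i => blockAvg (P := F.P K) (j := i) (expMeanLogSU (n := Fin 2))) (K - n) (Γ₀ s) c :
      Matrix.specialUnitaryGroup (Fin 2) ℂ) : Matrix (Fin 2) (Fin 2) ℂ)) 0‖ := Finset.sum_nonneg fun c _ => norm_nonneg _
  have hLk : 0 < (F.L : ℝ) ^ (K - n) := by positivity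
  calc _ ≤ ε₀ * (((F.L : ℝ) ^ (K - n)) ^ 3)⁻¹ * ∑ b : PBond (F.P K) 0, ‖A b - ξ b‖ := hstep1
    _ = ε₀ * (((F.L : ℝ) ^ (K - n)) ^ 3)⁻¹ * ∑ b : PBond (F.P K) 0,
          ‖deriv (fun s : ℝ => ((γ s b : Matrix.specialUnitaryGroup (Fin 2) ℂ) : Matrix (Fin 2) (Fin 2) ℂ)) 0
            - deriv (fun s : ℝ => ((Γ₀ s b : Matrix.specialUnitaryGroup (Fin 2) ℂ) : Matrix (Fin 2) (Fin 2) ℂ)) 0‖ := by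
        simp only [hAξ]
    _ ≤ ε₀ * (((F.L : ℝ) ^ (K - n)) ^ 3)⁻¹ * ((2 * ((F.L : ℝ) ^ (K - n)) ^ 2) * ∑ c : PBond (F.P K) (K - n),
          ‖deriv (fun s : ℝ => ((Averaging.iter (fun i => blockAvg (P := F.P K) (j := i) (expMeanLogSU (n := Fin 2))) (K - n) (Γ₀ s) c :
              Matrix.specialUnitaryGroup (Fin 2) ℂ) : Matrix (Fin 2) (Fin 2) ℂ)) 0‖) :=
        mul_le_mul_of_nonneg_left (hB.trans (mul_le_mul_of_nonneg_right hW hS0)) (by positivity)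
    _ = 2 * ε₀ * ((F.L : ℝ) ^ (K - n))⁻¹ * ∑ c : PBond (F.P K) (K - n),
          ‖deriv (fun s : ℝ => ((Averaging.iter (fun i => blockAvg (P := F.P K) (j := i) (expMeanLogSU (n := Fin 2))) (K - n) (Γ₀ s) c :
              Matrix.specialUnitaryGroup (Fin 2) ℂ) : Matrix (Fin 2) (Fin 2) ℂ)) 0‖ := by
        field_simp


end Summit.QuantumFields.YangMills.Theorems.Prop7FirstVariationWeakEL

end
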